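import Literature.Probability.LatticeModels.SlitPlaneKernel
import Literature.Probability.LatticeModels.HarmonicExtension
import Mathlib.MeasureTheory.Function.JacobianOneDim
import Mathlib.Analysis.SpecialFunctions.Trigonometric.ArctanDeriv
import Mathlib.Analysis.SpecialFunctions.Gaussian.GaussianIntegral
import Mathlib.Analysis.Calculus.Deriv.ZPow
import Mathlib.Analysis.Real.Pi.Bounds
import HarnessLib

/-!
# The slit-plane kernel, II: rational representation, Kesten's bound in all directions, and the identification with the tip harmonic measure

Topic `Literature/Probability/LatticeModels`; sequel of `SlitPlaneKernel.lean`, where the closed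
form `K(k, s) = (1/π)∫_{-π/2}^{π/2} Re(e^{-ikt}(1 - e^{2it})^{-1/2}) y(t)^s dt` (`slitKernel`,
`slitHM (a,b) = K(a+b, |a-b|)`) was shown to solve the defining problem of Chelkak–Hongler–Izyurov's
`F¹_{[ℂ_δ,a]} = hm^{Ξ_δ}_{a+3δ/2}` (Ann. of Math. 181 (2015) = arXiv:1202.2838, §3.2.1–3.2.2:
harmonic on `𝒱¹ ∖ (L_a ∪ {tip})`, `0` on the cut `L_a`, `1` at the tip) with the diagonal values
`binom(2j,j)/4^j`. This file proves what was deferred there: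

* **`slitKernel_eq_re_slitJ`** — the substitution `t = 2 arctan v²` turns the Fourier integral into
  the integral of a *rational* function on `[0, 1]`:
  `K(k, s) = (4/π) Re( e^{iπ/4} ∫_0^1 E(v)^k Y(v)^s A(v) dv )`,
  `E = (1 - iv²)/(1 + iv²)` (`|E| = 1`), `Y = (1 - v²)/(1 + v²) ∈ [0, 1]`, `A = 1/(1 + iv²)`
  (`e^{-iθ} = E`, `y(θ) = Y`, `ĝ(θ) = ½ e^{iπ/4}(1 - iv²)/v` at `θ = 2 arctan v²`, the last one by
  comparing squares and signs of real parts; the change of variables is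
  `MeasureTheory.integral_image_eq_integral_abs_deriv_smul` on `(0, 1) → (0, π/2)`).
* **Kesten's estimate in all directions** (CHI Lemma 3.3, (3.3): `hm ≤ C δ^{1/2}|z - a|^{-1/2}`;
  H. Kesten 1987; G. Lawler 1991, §2.4): `|J(k,s)| ≤ √(π/s)/2` (Gaussian comparison `Y ≤ e^{-v²}`)
  and `|J(k,s)| ≤ 3/√|k|` (one integration by parts against `(E^k)' = E^k · (-4ikv/(1+v⁴))`,
  with the explicit primitive `Ξ = (i/4k) Y^s (v⁻¹ - iv)`), whence
  `abs_slitKernel_le : |K(k, s)| ≤ 8/√(1 + |k| + s)` and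
  `abs_slitHM_le : |slitHM (a, b)| ≤ 8/√(1 + |a| + |b|)`.
* **`slitHM_nonneg`, `slitHM_le_one`** — `0 ≤ slitHM ≤ 1`, by the lattice maximum principle
  (`LatticeLaplacian.lean`) on the punctured boxes `U_N = {|a|+|b| < N} ∖ ({0} ∪ slit)` and the
  decay at infinity.
* **`abs_slitHM_sub_slitHMBox_le`, `tendsto_slitHMBox`** — the identification: the tip harmonic
  measures `slitHMBox N = harmExt U_N 1_{tip}` of the punctured boxes (harmonic on `U_N`, `1` at the
  tip, `0` on the slit and outside the box; `HarmonicExtension.lean`) satisfy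
  `|slitHM - slitHMBox N| ≤ 8/√(1+N)` everywhere, so converge to `slitHM`: the closed form IS the
  infinite-volume harmonic measure of the tip of the diagonal slit.

Everything is proved; no named fact. NOT here: the asymptotics
`K(k,s) = √(2/π) Re (k + ½ + i|s|)^{-1/2} + O(r^{-3/2})` (CHI Lemma 2.14 / 3.4 (iii); by rotating
the contour of `J` to the steepest-descent ray), the odd-sublattice partner and `G_{[ℂ_δ,a]}`.

## References

* D. Chelkak, C. Hongler, K. Izyurov, Ann. of Math. 181 (2015) 1087–1138 = arXiv:1202.2838, §3.2.1
  (Lemma 3.3), §3.2.2 (proof of Lemma 2.14) [ChelkakHonglerIzyurovAnnals2015].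
* H. Kesten, Stoch. Proc. Appl. 25 (1987) 165–184 [Kesten1987].
* G. F. Lawler, *Intersections of Random Walks* (1991), §2.4 [Lawler1991].
-/

noncomputable section

open Complex MeasureTheory intervalIntegral Set Filter Topology Metric
open scoped Real ComplexConjugate Interval

namespace Literature.Probability.LatticeModels

/-! ### Evenness in `t`: `K(k, s) = (2/π) ∫_0^{π/2}` -/

/-- `1 - e^{-iθ} = conj(1 - e^{iθ})`. [folklore] -/
theorem circBase_one_neg (θ : ℝ) : circBase 1 (-θ) = conj (circBase 1 θ) := by
  unfold circBase
  simp only [ofReal_one, one_mul, map_sub, map_one, ← Complex.exp_conj, map_mul, Complex.conj_ofReal,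
    Complex.conj_I, ofReal_neg]
  ring_nf

/-- `b_1(θ)` never has argument `π` (its real part is `1 - cos θ ≥ 0`). [folklore] -/
theorem arg_circBase_one_ne_pi (θ : ℝ) : (circBase 1 θ).arg ≠ π := by
  intro h
  rw [Complex.arg_eq_pi_iff, circBase_re, one_mul] at h
  linarith [Real.cos_le_one θ, h.1]

/-- `ĝ(-t) = conj ĝ(t)`. [folklore] -/
theorem slitGHat_neg (t : ℝ) : slitGHat (-t) = conj (slitGHat t) := by
  unfold slitGHat
  rw [show 2 * (-t) = -(2 * t) by ring, circBase_one_neg, Complex.conj_cpow _ _ (arg_circBase_one_ne_pi _)]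
  congr 2
  rw [neg_half_eq_ofReal, Complex.conj_ofReal]

/-- `e^{-ik(-t)} ĝ(-t) = conj(e^{-ikt} ĝ(t))`. [folklore] -/
theorem slitCFun_neg (k : ℤ) (t : ℝ) : slitCFun k (-t) = conj (slitCFun k t) := by
  unfold slitCFun
  rw [map_mul, slitGHat_neg, ← Complex.exp_conj]
  congr 2
  simp only [map_neg, map_mul, Complex.conj_ofReal, Complex.conj_I, ofReal_neg]
  have : conj (k : ℂ) = (k : ℂ) := by
    rw [show (k : ℂ) = ((k : ℝ) : ℂ) by norm_cast, Complex.conj_ofReal]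
  rw [this]; ring

/-- The kernel integrand is even in `t`. [folklore] -/
theorem slitKerFun_neg (k : ℤ) (s : ℕ) (t : ℝ) : slitKerFun k s (-t) = slitKerFun k s t := by
  unfold slitKerFun
  rw [slitCFun_neg, Complex.conj_re, chmY_neg]

/-- **`K(k, s) = (2/π) ∫_0^{π/2} Re(e^{-ikt} ĝ(t)) y(t)^s dt`.** [folklore] -/
theorem slitKernel_eq_half (k : ℤ) (s : ℕ) :
    slitKernel k s = 2 / π * ∫ t in (0 : ℝ)..(π / 2), slitKerFun k s t := by
  have hπ := Real.pi_pos
  have hI := intervalIntegrable_slitKerFun k s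
  have hsub1 : [[-(π / 2), (0 : ℝ)]] ⊆ [[-(π / 2), π / 2]] := by
    rw [uIcc_of_le (by linarith), uIcc_of_le (by linarith)]
    exact Icc_subset_Icc le_rfl (by linarith)
  have hsub2 : [[(0 : ℝ), π / 2]] ⊆ [[-(π / 2), π / 2]] := by
    rw [uIcc_of_le (by linarith), uIcc_of_le (by linarith)]
    exact Icc_subset_Icc (by linarith) le_rfl
  have h1 : IntervalIntegrable (slitKerFun k s) volume (-(π / 2)) 0 := hI.mono_set hsub1
  have h2 : IntervalIntegrable (slitKerFun k s) volume 0 (π / 2) := hI.mono_set hsub2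
  have hsplit : ∫ t in (-(π / 2))..(π / 2), slitKerFun k s t =
      (∫ t in (-(π / 2))..0, slitKerFun k s t) + ∫ t in (0 : ℝ)..(π / 2), slitKerFun k s t :=
    (intervalIntegral.integral_add_adjacent_intervals h1 h2).symm
  have hneg : ∫ t in (-(π / 2))..0, slitKerFun k s t = ∫ t in (0 : ℝ)..(π / 2), slitKerFun k s t := by
    have h := intervalIntegral.integral_comp_neg (a := 0) (b := π / 2) (f := slitKerFun k s)
    simp only [neg_zero] at h
    rw [← h]
    exact intervalIntegral.integral_congr fun t _ => slitKerFun_neg k s t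
  rw [slitKernel, hsplit, hneg]
  ring

/-! ### The rational functions `E`, `Y`, `A` -/

/-- `E(v) = (1 - iv²)/(1 + iv²)` (`= e^{-2i arctan v²}`). [folklore] -/
def slitE (v : ℝ) : ℂ := (1 - I * (v : ℂ) ^ 2) / (1 + I * (v : ℂ) ^ 2)

/-- `Y(v) = (1 - v²)/(1 + v²)` (`= y(2 arctan v²)`). [folklore] -/
def slitY (v : ℝ) : ℝ := (1 - v ^ 2) / (1 + v ^ 2)

/-- `A(v) = 1/(1 + iv²)`. [folklore] -/
def slitA (v : ℝ) : ℂ := (1 + I * (v : ℂ) ^ 2)⁻¹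

/-- `Im(v²) = 0` for real `v`. [folklore] -/
theorem ofReal_sq_im (v : ℝ) : ((v : ℂ) ^ 2).im = 0 := by rw [← ofReal_pow, ofReal_im]

/-- `Re(v²) = v²` for real `v`. [folklore] -/
theorem ofReal_sq_re (v : ℝ) : ((v : ℂ) ^ 2).re = v ^ 2 := by rw [← ofReal_pow, ofReal_re]

/-- `Re(iv²) = 0`. [folklore] -/
theorem I_mul_sq_re (v : ℝ) : (I * (v : ℂ) ^ 2).re = 0 := by
  simp [Complex.mul_re, ofReal_sq_im]

/-- `Im(iv²) = v²`. [folklore] -/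
theorem I_mul_sq_im (v : ℝ) : (I * (v : ℂ) ^ 2).im = v ^ 2 := by
  simp [Complex.mul_im, ofReal_sq_re]

/-- `(1 - iv²)(1 + iv²) = 1 + v⁴`. [folklore] -/
theorem one_sub_I_mul_sq_mul (v : ℝ) : (1 - I * (v : ℂ) ^ 2) * (1 + I * (v : ℂ) ^ 2) = 1 + (v : ℂ) ^ 4 := by
  linear_combination (-(v : ℂ) ^ 4) * Complex.I_sq

/-- `Re(1 + iv²) = 1`. [folklore] -/
theorem one_add_I_mul_sq_re (v : ℝ) : ((1 : ℂ) + I * (v : ℂ) ^ 2).re = 1 := by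
  rw [Complex.add_re, Complex.one_re, I_mul_sq_re, add_zero]

/-- `1 + iv² ≠ 0`. [folklore] -/
theorem one_add_I_mul_sq_ne_zero (v : ℝ) : (1 : ℂ) + I * (v : ℂ) ^ 2 ≠ 0 := by
  intro h
  have := congrArg Complex.re h
  rw [one_add_I_mul_sq_re, Complex.zero_re] at this
  exact one_ne_zero this

/-- `1 - iv² = conj(1 + iv²)`. [folklore] -/
theorem one_sub_I_mul_sq_eq_conj (v : ℝ) : (1 : ℂ) - I * (v : ℂ) ^ 2 = conj ((1 : ℂ) + I * (v : ℂ) ^ 2) := by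
  rw [map_add, map_one, map_mul, Complex.conj_I, map_pow, Complex.conj_ofReal]; ring

/-- `1 - iv² ≠ 0`. [folklore] -/
theorem one_sub_I_mul_sq_ne_zero (v : ℝ) : (1 : ℂ) - I * (v : ℂ) ^ 2 ≠ 0 := by
  rw [one_sub_I_mul_sq_eq_conj]
  exact (map_ne_zero _).2 (one_add_I_mul_sq_ne_zero v)

/-- `1 + v² ≠ 0`. [folklore] -/
theorem one_add_sq_ne_zero' (v : ℝ) : (1 : ℝ) + v ^ 2 ≠ 0 := by positivity

/-- `E(v) ≠ 0`. [folklore] -/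
theorem slitE_ne_zero (v : ℝ) : slitE v ≠ 0 :=
  div_ne_zero (one_sub_I_mul_sq_ne_zero v) (one_add_I_mul_sq_ne_zero v)

/-- `‖1 - iv²‖ = ‖1 + iv²‖`. [folklore] -/
theorem norm_one_sub_I_mul_sq (v : ℝ) : ‖(1 : ℂ) - I * (v : ℂ) ^ 2‖ = ‖(1 : ℂ) + I * (v : ℂ) ^ 2‖ := by
  rw [one_sub_I_mul_sq_eq_conj, Complex.norm_conj]

/-- **`|E(v)| = 1`.** [folklore] -/
theorem norm_slitE (v : ℝ) : ‖slitE v‖ = 1 := by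
  rw [slitE, norm_div, norm_one_sub_I_mul_sq, div_self]
  exact norm_ne_zero_iff.2 (one_add_I_mul_sq_ne_zero v)

/-- `|E(v)^k| = 1`. [folklore] -/
theorem norm_slitE_zpow (v : ℝ) (k : ℤ) : ‖slitE v ^ k‖ = 1 := by
  rw [norm_zpow, norm_slitE, one_zpow]

/-- `0 ≤ Y ≤ 1` on `[0, 1]`… more precisely `Y(v) ≤ 1` always and `0 ≤ Y(v)` for `|v| ≤ 1`. [folklore] -/
theorem slitY_le_one (v : ℝ) : slitY v ≤ 1 := by
  rw [slitY, div_le_one (by positivity)]; nlinarith [sq_nonneg v]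

/-- `0 ≤ Y(v)` for `v² ≤ 1`. [folklore] -/
theorem slitY_nonneg {v : ℝ} (hv : v ^ 2 ≤ 1) : 0 ≤ slitY v := by
  rw [slitY]; exact div_nonneg (by linarith) (by positivity)

/-- `‖1 + iv²‖ ≥ 1`. [folklore] -/
theorem one_le_norm_one_add_I_mul_sq (v : ℝ) : 1 ≤ ‖(1 : ℂ) + I * (v : ℂ) ^ 2‖ := by
  calc (1 : ℝ) = |((1 : ℂ) + I * (v : ℂ) ^ 2).re| := by rw [one_add_I_mul_sq_re, abs_one]
    _ ≤ ‖(1 : ℂ) + I * (v : ℂ) ^ 2‖ := abs_re_le_norm _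

/-- `‖A(v)‖ ≤ 1`. [folklore] -/
theorem norm_slitA_le (v : ℝ) : ‖slitA v‖ ≤ 1 := by
  rw [slitA, norm_inv]
  exact inv_le_one_of_one_le₀ (one_le_norm_one_add_I_mul_sq v)

/-- `E`, `Y`, `A` are continuous. [folklore] -/
theorem continuous_slitE : Continuous slitE := by
  unfold slitE
  exact Continuous.div (by fun_prop) (by fun_prop) one_add_I_mul_sq_ne_zero

/-- `Y` is continuous. [folklore] -/
theorem continuous_slitY : Continuous slitY := by
  unfold slitY
  exact Continuous.div (by fun_prop) (by fun_prop) one_add_sq_ne_zero'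

/-- `A` is continuous. [folklore] -/
theorem continuous_slitA : Continuous slitA := by
  unfold slitA
  exact Continuous.inv₀ (by fun_prop) one_add_I_mul_sq_ne_zero

/-- **The rational integrand** `E(v)^k Y(v)^s A(v)`. [folklore] -/
def slitJFun (k : ℤ) (s : ℕ) (v : ℝ) : ℂ := slitE v ^ k * ((slitY v : ℝ) : ℂ) ^ s * slitA v

/-- The rational integrand is continuous. [folklore] -/
theorem continuous_slitJFun (k : ℤ) (s : ℕ) : Continuous (slitJFun k s) := by
  unfold slitJFun
  refine Continuous.mul (Continuous.mul ?_ ((continuous_ofReal.comp continuous_slitY).pow s)) continuous_slitA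
  exact continuous_slitE.zpow₀ k fun v => Or.inl (slitE_ne_zero v)

/-- `‖E^k Y^s A‖ ≤ Y^s ≤ 1` on `[0, 1]`. [folklore] -/
theorem norm_slitJFun_le {v : ℝ} (hv : v ^ 2 ≤ 1) (k : ℤ) (s : ℕ) : ‖slitJFun k s v‖ ≤ slitY v ^ s := by
  rw [slitJFun, norm_mul, norm_mul, norm_slitE_zpow, one_mul, norm_pow, Complex.norm_real, Real.norm_eq_abs,
    abs_of_nonneg (slitY_nonneg hv)]
  calc slitY v ^ s * ‖slitA v‖ ≤ slitY v ^ s * 1 :=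
        mul_le_mul_of_nonneg_left (norm_slitA_le v) (pow_nonneg (slitY_nonneg hv) s)
    _ = _ := mul_one _

/-- **`J(k, s) = ∫_0^1 E(v)^k Y(v)^s A(v) dv`.** [folklore] -/
def slitJ (k : ℤ) (s : ℕ) : ℂ := ∫ v in (0 : ℝ)..1, slitJFun k s v

/-! ### The change of variables `t = 2 arctan v²` -/

/-- `θ(v) = 2 arctan(v²)`. [folklore] -/
def slitTheta (v : ℝ) : ℝ := 2 * Real.arctan (v ^ 2)

/-- `θ'(v) = 4v/(1 + v⁴)`. [folklore] -/
theorem hasDerivAt_slitTheta (v : ℝ) : HasDerivAt slitTheta (4 * v / (1 + v ^ 4)) v := by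
  have h1 : HasDerivAt (fun x : ℝ => x ^ 2) (2 * v) v := by simpa using hasDerivAt_pow 2 v
  have h2 := (Real.hasDerivAt_arctan (v ^ 2)).comp v h1
  have h3 := h2.const_mul (2 : ℝ)
  have h4 : HasDerivAt slitTheta (2 * (1 / (1 + (v ^ 2) ^ 2) * (2 * v))) v := h3
  refine h4.congr_deriv ?_
  rw [show (v ^ 2) ^ 2 = v ^ 4 by ring]
  field_simp
  ring

/-- `θ` is strictly increasing on `[0, ∞)`. [folklore] -/
theorem slitTheta_strictMonoOn : StrictMonoOn slitTheta (Ici 0) := by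
  intro a ha b hb hab
  unfold slitTheta
  have : a ^ 2 < b ^ 2 := by
    rw [mem_Ici] at ha hb
    nlinarith
  have := Real.arctan_strictMono this
  linarith

/-- `θ` is continuous. [folklore] -/
theorem continuous_slitTheta : Continuous slitTheta := by
  unfold slitTheta; fun_prop

/-- `θ(0) = 0`, `θ(1) = π/2`. [folklore] -/
theorem slitTheta_zero : slitTheta 0 = 0 := by simp [slitTheta]

/-- `θ(1) = π/2`. [folklore] -/
theorem slitTheta_one : slitTheta 1 = π / 2 := by
  rw [slitTheta, one_pow, Real.arctan_one]; ring

/-- `θ` maps `(0, 1)` onto `(0, π/2)`. [folklore] -/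
theorem slitTheta_image_Ioo : slitTheta '' Ioo 0 1 = Ioo 0 (π / 2) := by
  apply Subset.antisymm
  · rintro _ ⟨v, hv, rfl⟩
    rw [← slitTheta_zero, ← slitTheta_one]
    exact ⟨slitTheta_strictMonoOn (mem_Ici.2 le_rfl) (mem_Ici.2 hv.1.le) hv.1,
      slitTheta_strictMonoOn (mem_Ici.2 hv.1.le) (mem_Ici.2 zero_le_one) hv.2⟩
  · have h := intermediate_value_Ioo zero_le_one continuous_slitTheta.continuousOn
    rw [slitTheta_zero, slitTheta_one] at h
    exact h

/-- `cos θ(v) = (1 - v⁴)/(1 + v⁴)`, `sin θ(v) = 2v²/(1 + v⁴)`. [folklore] -/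
theorem cos_slitTheta (v : ℝ) : Real.cos (slitTheta v) = (1 - v ^ 4) / (1 + v ^ 4) := by
  rw [slitTheta, Real.cos_two_mul, Real.cos_sq_arctan]
  rw [show (v ^ 2) ^ 2 = v ^ 4 by ring]
  have h : (1 : ℝ) + v ^ 4 ≠ 0 := by positivity
  field_simp
  ring

/-- `sin θ(v) = 2v²/(1 + v⁴)`. [folklore] -/
theorem sin_slitTheta (v : ℝ) : Real.sin (slitTheta v) = 2 * v ^ 2 / (1 + v ^ 4) := by
  rw [slitTheta, Real.sin_two_mul, Real.sin_arctan, Real.cos_arctan]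
  rw [show (v ^ 2) ^ 2 = v ^ 4 by ring]
  have h : 0 < 1 + v ^ 4 := by positivity
  have hs : Real.sqrt (1 + v ^ 4) ≠ 0 := (Real.sqrt_pos.2 h).ne'
  have hs2 : Real.sqrt (1 + v ^ 4) ^ 2 = 1 + v ^ 4 := Real.sq_sqrt h.le
  field_simp
  rw [hs2]

/-- **`y(θ(v)) = Y(v)`.** [folklore] -/
theorem chmY_slitTheta (v : ℝ) : chmY (slitTheta v) = slitY v := by
  rw [chmY, cos_slitTheta, sin_slitTheta, abs_of_nonneg (by positivity), slitY]
  have h : 0 < 1 + v ^ 4 := by positivity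
  have h2 : (0 : ℝ) < 1 + v ^ 2 := by positivity
  field_simp
  ring

/-- **`e^{-iθ(v)} = E(v)`.** [folklore] -/
theorem cexp_neg_slitTheta_mul_I (v : ℝ) : cexp (-(slitTheta v : ℂ) * I) = slitE v := by
  rw [show -(slitTheta v : ℂ) * I = ((-slitTheta v : ℝ) : ℂ) * I by push_cast; ring, Complex.exp_mul_I,
    ← ofReal_cos, ← ofReal_sin, Real.cos_neg, Real.sin_neg, cos_slitTheta, sin_slitTheta, slitE]
  have h : ((1 : ℂ) + (v : ℂ) ^ 4) ≠ 0 := by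
    have : (0 : ℝ) < 1 + v ^ 4 := by positivity
    exact_mod_cast this.ne'
  have h1 := one_add_I_mul_sq_ne_zero v
  have hpoly : ((1 - (v : ℂ) ^ 4) - 2 * (v : ℂ) ^ 2 * I) * (1 + I * (v : ℂ) ^ 2) =
      (1 - I * (v : ℂ) ^ 2) * (1 + (v : ℂ) ^ 4) := by
    linear_combination (-2 * (v : ℂ) ^ 4) * Complex.I_sq
  have hlhs : (((1 - v ^ 4) / (1 + v ^ 4) : ℝ) : ℂ) + ((-(2 * v ^ 2 / (1 + v ^ 4)) : ℝ) : ℂ) * I =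
      ((1 - (v : ℂ) ^ 4) - 2 * (v : ℂ) ^ 2 * I) / (1 + (v : ℂ) ^ 4) := by
    push_cast
    field_simp
    ring
  rw [hlhs, div_eq_div_iff h h1]
  exact hpoly

/-- `e^{iθ(v)} = E(v)⁻¹`. [folklore] -/
theorem cexp_slitTheta_mul_I (v : ℝ) : cexp ((slitTheta v : ℂ) * I) = (slitE v)⁻¹ := by
  rw [← cexp_neg_slitTheta_mul_I, ← Complex.exp_neg]
  ring_nf

/-- **`e^{-ikθ(v)} = E(v)^k`.** [folklore] -/
theorem cexp_neg_int_mul_slitTheta (k : ℤ) (v : ℝ) :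
    cexp (-((k : ℂ) * (slitTheta v : ℂ) * I)) = slitE v ^ k := by
  rw [show -((k : ℂ) * (slitTheta v : ℂ) * I) = k * (-(slitTheta v : ℂ) * I) by ring, Complex.exp_int_mul,
    cexp_neg_slitTheta_mul_I]

/-- `1 - e^{2iθ(v)} = -4iv²/(1 - iv²)²`. [folklore] -/
theorem circBase_one_two_mul_slitTheta (v : ℝ) :
    circBase 1 (2 * slitTheta v) = -4 * I * (v : ℂ) ^ 2 / (1 - I * (v : ℂ) ^ 2) ^ 2 := by
  unfold circBase
  rw [show ((2 * slitTheta v : ℝ) : ℂ) * I = (2 : ℕ) * ((slitTheta v : ℂ) * I) by push_cast; ring,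
    Complex.exp_nat_mul, cexp_slitTheta_mul_I, slitE, inv_div, div_pow, ofReal_one, one_mul,
    one_sub_div (pow_ne_zero 2 (one_sub_I_mul_sq_ne_zero v))]
  congr 1
  ring

/-- The principal `-1/2` power of a number with nonnegative real part has positive real part
(unless the number is `0`). [folklore] -/
theorem re_cpow_neg_half_pos {z : ℂ} (hz : z ≠ 0) (hre : 0 ≤ z.re) : 0 < (z ^ (-(1 / 2 : ℂ))).re := by
  rw [neg_half_eq_ofReal, Complex.cpow_ofReal_re]
  have h1 : 0 < ‖z‖ ^ (-(1 / 2 : ℝ)) := Real.rpow_pos_of_pos (norm_pos_iff.2 hz) _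
  have h2 : |z.arg| ≤ π / 2 := Complex.abs_arg_le_pi_div_two_iff.2 hre
  have h3 : 0 < Real.cos (z.arg * (-(1 / 2 : ℝ))) := by
    apply Real.cos_pos_of_mem_Ioo
    constructor <;> nlinarith [abs_le.1 h2, Real.pi_pos]
  exact mul_pos h1 h3

/-- `e^{iπ/4} = (√2/2)(1 + i)`. [folklore] -/
theorem cexp_pi_div_four_mul_I :
    cexp (π / 4 * I) = ((Real.sqrt 2 / 2 : ℝ) : ℂ) + ((Real.sqrt 2 / 2 : ℝ) : ℂ) * I := by
  rw [show (π / 4 * I : ℂ) = ((π / 4 : ℝ) : ℂ) * I by push_cast; ring, Complex.exp_mul_I, ← ofReal_cos,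
    ← ofReal_sin, Real.cos_pi_div_four, Real.sin_pi_div_four]

/-- `(e^{iπ/4})² = i`. [folklore] -/
theorem cexp_pi_div_four_mul_I_sq : cexp (π / 4 * I) ^ 2 = I := by
  rw [← Complex.exp_nat_mul, show ((2 : ℕ) : ℂ) * (π / 4 * I) = (π / 2) * I by push_cast; ring,
    Complex.exp_mul_I, Complex.cos_pi_div_two, Complex.sin_pi_div_two]
  ring

/-- **`ĝ(θ(v)) = ½ e^{iπ/4} (1 - iv²)/v`** for `v > 0`: both sides square to
`(1 - e^{2iθ})^{-1} = i(1 - iv²)²/(4v²)` and have positive real part. [folklore] -/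
theorem slitGHat_slitTheta {v : ℝ} (hv : 0 < v) :
    slitGHat (slitTheta v) = (1 / 2 : ℂ) * cexp (π / 4 * I) * (1 - I * (v : ℂ) ^ 2) / (v : ℂ) := by
  have hv0 : (v : ℂ) ≠ 0 := by exact_mod_cast hv.ne'
  have hv2 : (v : ℂ) ^ 2 ≠ 0 := pow_ne_zero 2 hv0
  have h2 := one_sub_I_mul_sq_ne_zero v
  set B := circBase 1 (2 * slitTheta v) with hB
  have hnum : -4 * I * (v : ℂ) ^ 2 ≠ 0 := by
    have : (-4 : ℂ) ≠ 0 := by norm_num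
    exact mul_ne_zero (mul_ne_zero this I_ne_zero) hv2
  have hBne : B ≠ 0 := by
    rw [hB, circBase_one_two_mul_slitTheta]
    exact div_ne_zero hnum (pow_ne_zero 2 h2)
  have hBre : 0 ≤ B.re := by
    rw [hB, circBase_re, one_mul]; linarith [Real.cos_le_one (2 * slitTheta v)]
  -- the candidate
  set w : ℂ := (1 / 2 : ℂ) * cexp (π / 4 * I) * (1 - I * (v : ℂ) ^ 2) / (v : ℂ) with hw
  have hw_sq : w ^ 2 = B⁻¹ := by
    rw [hw, hB, circBase_one_two_mul_slitTheta, div_pow, mul_pow, mul_pow, cexp_pi_div_four_mul_I_sq, inv_div,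
      div_eq_div_iff hv2 hnum]
    linear_combination (-(v : ℂ) ^ 2 * (1 - I * (v : ℂ) ^ 2) ^ 2) * Complex.I_sq
  have hw_re : 0 < w.re := by
    rw [hw, Complex.div_ofReal_re]
    apply div_pos _ hv
    have hc : ((1 / 2 : ℂ) * cexp (π / 4 * I)) = ((Real.sqrt 2 / 4 : ℝ) : ℂ) + ((Real.sqrt 2 / 4 : ℝ) : ℂ) * I := by
      rw [cexp_pi_div_four_mul_I]; push_cast; ring
    rw [hc, Complex.mul_re]
    have e1 : (((Real.sqrt 2 / 4 : ℝ) : ℂ) + ((Real.sqrt 2 / 4 : ℝ) : ℂ) * I).re = Real.sqrt 2 / 4 := by simp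
    have e2 : (((Real.sqrt 2 / 4 : ℝ) : ℂ) + ((Real.sqrt 2 / 4 : ℝ) : ℂ) * I).im = Real.sqrt 2 / 4 := by simp
    have e3 : ((1 : ℂ) - I * (v : ℂ) ^ 2).re = 1 := by
      rw [Complex.sub_re, Complex.one_re, I_mul_sq_re, sub_zero]
    have e4 : ((1 : ℂ) - I * (v : ℂ) ^ 2).im = -v ^ 2 := by
      rw [Complex.sub_im, Complex.one_im, I_mul_sq_im, zero_sub]
    rw [e1, e2, e3, e4]
    have : (0 : ℝ) < Real.sqrt 2 := Real.sqrt_pos.2 (by norm_num)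
    nlinarith [sq_nonneg v]
  have hg_sq : slitGHat (slitTheta v) ^ 2 = B⁻¹ := by
    rw [slitGHat, ← hB, sq, ← cpow_add _ _ hBne, show -(1 / 2 : ℂ) + -(1 / 2 : ℂ) = -1 by norm_num,
      cpow_neg_one]
  have hg_re : 0 < (slitGHat (slitTheta v)).re := by
    rw [slitGHat, ← hB]; exact re_cpow_neg_half_pos hBne hBre
  -- square roots with positive real part are unique
  rcases sq_eq_sq_iff_eq_or_eq_neg.1 (hg_sq.trans hw_sq.symm) with h' | h'
  · exact h'
  · rw [h', Complex.neg_re] at hg_re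
    linarith

/-- **The pointwise identity behind the substitution**: for `0 < v`,
`θ'(v) · Re(e^{-ikθ} ĝ(θ)) y(θ)^s = 2 Re(e^{iπ/4} E^k Y^s A)` at `θ = θ(v)`. [folklore] -/
theorem deriv_slitTheta_mul_slitKerFun {v : ℝ} (hv : 0 < v) (k : ℤ) (s : ℕ) :
    4 * v / (1 + v ^ 4) * slitKerFun k s (slitTheta v) = 2 * (cexp (π / 4 * I) * slitJFun k s v).re := by
  have hv0 : (v : ℂ) ≠ 0 := by exact_mod_cast hv.ne'
  have h1 := one_add_I_mul_sq_ne_zero v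
  have h2 := one_sub_I_mul_sq_ne_zero v
  have h4 : ((1 : ℂ) + (v : ℂ) ^ 4) ≠ 0 := by
    have : (0 : ℝ) < 1 + v ^ 4 := by positivity
    exact_mod_cast this.ne'
  -- the complex identity `θ' e^{-ikθ} ĝ = 2 e^{iπ/4} E^k A`
  have key : (((4 * v / (1 + v ^ 4) : ℝ)) : ℂ) * slitCFun k (slitTheta v) =
      2 * (cexp (π / 4 * I) * (slitE v ^ k * slitA v)) := by
    rw [slitCFun, cexp_neg_int_mul_slitTheta, slitGHat_slitTheta hv, slitA]
    have hA : (1 - I * (v : ℂ) ^ 2) / ((1 : ℂ) + (v : ℂ) ^ 4) = (1 + I * (v : ℂ) ^ 2)⁻¹ := by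
      rw [div_eq_iff h4, ← one_sub_I_mul_sq_mul, mul_comm (1 - I * (v : ℂ) ^ 2) _, inv_mul_cancel_left₀ h1]
    rw [← hA]
    push_cast
    field_simp
    ring
  unfold slitKerFun slitJFun
  rw [chmY_slitTheta]
  have hre : 4 * v / (1 + v ^ 4) * (slitCFun k (slitTheta v)).re =
      ((((4 * v / (1 + v ^ 4) : ℝ)) : ℂ) * slitCFun k (slitTheta v)).re := by
    rw [Complex.re_ofReal_mul]
  rw [← mul_assoc, hre, key]
  -- `Re(2 c E^k A) Y^s = 2 Re(c E^k Y^s A)` since `Y` is real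
  have : cexp (π / 4 * I) * (slitE v ^ k * ((slitY v : ℝ) : ℂ) ^ s * slitA v) =
      ((slitY v ^ s : ℝ) : ℂ) * (cexp (π / 4 * I) * (slitE v ^ k * slitA v)) := by push_cast; ring
  rw [this, Complex.re_ofReal_mul]
  have e2 : ((2 : ℂ) * (cexp (π / 4 * I) * (slitE v ^ k * slitA v))).re =
      2 * (cexp (π / 4 * I) * (slitE v ^ k * slitA v)).re := by
    rw [show (2 : ℂ) = ((2 : ℝ) : ℂ) by norm_num, Complex.re_ofReal_mul]
  rw [e2]; ring

/-- **The rational representation of the slit-plane kernel**: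
`K(k, s) = (4/π) Re( e^{iπ/4} ∫_0^1 E(v)^k Y(v)^s A(v) dv )`. [folklore] -/
theorem slitKernel_eq_re_slitJ (k : ℤ) (s : ℕ) :
    slitKernel k s = 4 / π * (cexp (π / 4 * I) * slitJ k s).re := by
  have hπ := Real.pi_pos
  -- the substitution on `(0, 1) → (0, π/2)`
  have hderiv : ∀ v ∈ Ioo (0 : ℝ) 1, HasDerivWithinAt slitTheta (4 * v / (1 + v ^ 4)) (Ioo 0 1) v :=
    fun v _ => (hasDerivAt_slitTheta v).hasDerivWithinAt
  have hinj : InjOn slitTheta (Ioo 0 1) :=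
    slitTheta_strictMonoOn.injOn.mono fun v hv => mem_Ici.2 hv.1.le
  have hcv := integral_image_eq_integral_abs_deriv_smul measurableSet_Ioo hderiv hinj (slitKerFun k s)
  rw [slitTheta_image_Ioo] at hcv
  -- rewrite both sides as interval integrals
  have hL : ∫ t in (0 : ℝ)..(π / 2), slitKerFun k s t = ∫ t in Ioo 0 (π / 2), slitKerFun k s t := by
    rw [intervalIntegral.integral_of_le (by linarith), integral_Ioc_eq_integral_Ioo]
  have hR : ∫ v in Ioo (0 : ℝ) 1, |4 * v / (1 + v ^ 4)| • slitKerFun k s (slitTheta v) =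
      ∫ v in (0 : ℝ)..1, 2 * (cexp (π / 4 * I) * slitJFun k s v).re := by
    rw [intervalIntegral.integral_of_le zero_le_one, integral_Ioc_eq_integral_Ioo]
    refine setIntegral_congr_fun measurableSet_Ioo fun v hv => ?_
    rw [smul_eq_mul, abs_of_pos (by have := hv.1; positivity), deriv_slitTheta_mul_slitKerFun hv.1]
  have hre : ∫ v in (0 : ℝ)..1, 2 * (cexp (π / 4 * I) * slitJFun k s v).re =
      2 * (cexp (π / 4 * I) * slitJ k s).re := by
    have hI : IntervalIntegrable (fun v => cexp (π / 4 * I) * slitJFun k s v) volume 0 1 :=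
      ((continuous_slitJFun k s).const_mul _).intervalIntegrable _ _
    have h := intervalIntegral_re hI
    simp only [RCLike.re_to_complex] at h
    rw [intervalIntegral.integral_const_mul, h, slitJ, intervalIntegral.integral_const_mul]
  rw [slitKernel_eq_half, hL, hcv, hR, hre]
  ring


/-! ### Decay in `s`: `|J(k, s)| ≤ √(π/s)/2` -/

/-- The rational integrand is interval integrable. [folklore] -/
theorem intervalIntegrable_slitJFun (k : ℤ) (s : ℕ) (a b : ℝ) :
    IntervalIntegrable (slitJFun k s) volume a b :=
  (continuous_slitJFun k s).intervalIntegrable a b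

/-- `|J(k, s)| ≤ ∫_0^1 Y^s`. [folklore] -/
theorem norm_slitJ_le_integral (k : ℤ) (s : ℕ) : ‖slitJ k s‖ ≤ ∫ v in (0 : ℝ)..1, slitY v ^ s := by
  refine (intervalIntegral.norm_integral_le_integral_norm zero_le_one).trans ?_
  refine intervalIntegral.integral_mono_on zero_le_one ?_ ?_ fun v hv => ?_
  · exact (continuous_slitJFun k s).norm.intervalIntegrable _ _
  · exact (continuous_slitY.pow s).intervalIntegrable _ _
  · exact norm_slitJFun_le (by nlinarith [hv.1, hv.2]) k s

/-- **`|J(k, s)| ≤ 1`.** [folklore] -/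
theorem norm_slitJ_le_one (k : ℤ) (s : ℕ) : ‖slitJ k s‖ ≤ 1 := by
  refine (norm_slitJ_le_integral k s).trans ?_
  have h : ∫ v in (0 : ℝ)..1, slitY v ^ s ≤ ∫ v in (0 : ℝ)..1, (1 : ℝ) := by
    refine intervalIntegral.integral_mono_on zero_le_one ((continuous_slitY.pow s).intervalIntegrable _ _)
      intervalIntegrable_const fun v hv => ?_
    exact pow_le_one₀ (slitY_nonneg (by nlinarith [hv.1, hv.2])) (slitY_le_one v)
  simpa using h

/-- `Y(v) ≤ e^{-v²}` for `v² ≤ 1`. [folklore] -/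
theorem slitY_le_exp_neg_sq {v : ℝ} (hv : v ^ 2 ≤ 1) : slitY v ≤ Real.exp (-v ^ 2) := by
  have h1 : slitY v ≤ 1 - v ^ 2 := by
    rw [slitY, div_le_iff₀ (by positivity)]
    nlinarith [sq_nonneg v]
  exact h1.trans (Real.one_sub_le_exp_neg _)

/-- **Decay in `s`**: `|J(k, s)| ≤ √(π/s)/2` for `s ≥ 1` (Gaussian comparison `Y ≤ e^{-v²}`). [folklore] -/
theorem norm_slitJ_le_sqrt (k : ℤ) {s : ℕ} (hs : 1 ≤ s) : ‖slitJ k s‖ ≤ Real.sqrt (π / s) / 2 := by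
  have hs0 : (0 : ℝ) < s := by exact_mod_cast hs
  refine (norm_slitJ_le_integral k s).trans ?_
  have h1 : ∫ v in (0 : ℝ)..1, slitY v ^ s ≤ ∫ v in (0 : ℝ)..1, Real.exp (-(s : ℝ) * v ^ 2) := by
    refine intervalIntegral.integral_mono_on zero_le_one ((continuous_slitY.pow s).intervalIntegrable _ _)
      ((integrable_exp_neg_mul_sq hs0).intervalIntegrable) fun v hv => ?_
    have hv2 : v ^ 2 ≤ 1 := by nlinarith [hv.1, hv.2]
    calc slitY v ^ s ≤ Real.exp (-v ^ 2) ^ s := pow_le_pow_left₀ (slitY_nonneg hv2) (slitY_le_exp_neg_sq hv2) s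
      _ = Real.exp (-(s : ℝ) * v ^ 2) := by rw [← Real.exp_nat_mul]; ring_nf
  have h2 : ∫ v in (0 : ℝ)..1, Real.exp (-(s : ℝ) * v ^ 2) ≤ ∫ v in Ioi (0 : ℝ), Real.exp (-(s : ℝ) * v ^ 2) := by
    rw [intervalIntegral.integral_of_le zero_le_one]
    exact setIntegral_mono_set (integrable_exp_neg_mul_sq hs0).integrableOn
      (Eventually.of_forall fun v => (Real.exp_pos _).le) (Eventually.of_forall fun v hv => hv.1)
  rw [integral_gaussian_Ioi] at h2
  exact h1.trans h2

/-! ### Decay in `k`: `|J(k, s)| ≤ 3/√|k|` by one integration by parts -/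

/-- Derivative of `x ↦ (x : ℂ)²` along the real line. [folklore] -/
theorem hasDerivAt_ofReal_sq (v : ℝ) : HasDerivAt (fun x : ℝ => (x : ℂ) ^ 2) (2 * (v : ℂ)) v := by
  have h0 : HasDerivAt (fun x : ℝ => x ^ 2) (2 * v) v := by simpa using hasDerivAt_pow 2 v
  have h1 := h0.ofReal_comp
  have hf : (fun x : ℝ => (x : ℂ) ^ 2) = fun x : ℝ => ((x ^ 2 : ℝ) : ℂ) := by funext x; push_cast; rfl
  rw [hf]
  have hd : (((2 * v : ℝ)) : ℂ) = 2 * (v : ℂ) := by push_cast; rfl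
  rw [← hd]
  exact h1

/-- The derivative `Y'` as a continuous function. [folklore] -/
theorem continuous_derivY : Continuous fun v : ℝ => -4 * v / (1 + v ^ 2) ^ 2 :=
  Continuous.div (by fun_prop) (by fun_prop) fun v => pow_ne_zero 2 (one_add_sq_ne_zero' v)

/-- Derivative of `E`: `E'(v) = E(v) · (-4iv/(1 + v⁴))`. [folklore] -/
theorem hasDerivAt_slitE (v : ℝ) : HasDerivAt slitE (slitE v * (-4 * I * v / (1 + (v : ℂ) ^ 4))) v := by
  have h1 := one_add_I_mul_sq_ne_zero v
  have h2 := one_sub_I_mul_sq_ne_zero v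
  have h4 : ((1 : ℂ) + (v : ℂ) ^ 4) ≠ 0 := by rw [← one_sub_I_mul_sq_mul]; exact mul_ne_zero h2 h1
  have hsq := hasDerivAt_ofReal_sq v
  have hnum : HasDerivAt (fun x : ℝ => 1 - I * (x : ℂ) ^ 2) (-(I * (2 * (v : ℂ)))) v :=
    (hsq.const_mul I).const_sub 1
  have hden : HasDerivAt (fun x : ℝ => 1 + I * (x : ℂ) ^ 2) (I * (2 * (v : ℂ))) v :=
    (hsq.const_mul I).const_add 1
  have h := hnum.div hden h1
  refine h.congr_deriv ?_
  rw [slitE]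
  field_simp
  rw [← one_sub_I_mul_sq_mul]
  ring

/-- Derivative of `E^k`: `(E^k)' = E^k · (-4ikv/(1 + v⁴))`. [folklore] -/
theorem hasDerivAt_slitE_zpow (k : ℤ) (v : ℝ) :
    HasDerivAt (fun x : ℝ => slitE x ^ k) (slitE v ^ k * (-4 * I * k * v / (1 + (v : ℂ) ^ 4))) v := by
  have h := (hasDerivAt_zpow k (slitE v) (Or.inl (slitE_ne_zero v))).comp v (hasDerivAt_slitE v)
  refine h.congr_deriv ?_
  have hE := slitE_ne_zero v
  have h1 := one_add_I_mul_sq_ne_zero v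
  have h2 := one_sub_I_mul_sq_ne_zero v
  have h4 : ((1 : ℂ) + (v : ℂ) ^ 4) ≠ 0 := by rw [← one_sub_I_mul_sq_mul]; exact mul_ne_zero h2 h1
  rw [zpow_sub_one₀ hE]
  field_simp

/-- Derivative of `Y`: `Y'(v) = -4v/(1 + v²)²`. [folklore] -/
theorem hasDerivAt_slitY (v : ℝ) : HasDerivAt slitY (-4 * v / (1 + v ^ 2) ^ 2) v := by
  have hsq : HasDerivAt (fun x : ℝ => x ^ 2) (2 * v) v := by simpa using hasDerivAt_pow 2 v
  have hnum : HasDerivAt (fun x : ℝ => 1 - x ^ 2) (-(2 * v)) v := hsq.const_sub 1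
  have hden : HasDerivAt (fun x : ℝ => 1 + x ^ 2) (2 * v) v := hsq.const_add 1
  have h := hnum.div hden (one_add_sq_ne_zero' v)
  refine h.congr_deriv ?_
  field_simp
  ring

/-- `Y' ≤ 0` on `[0, ∞)`. [folklore] -/
theorem deriv_slitY_nonpos {v : ℝ} (hv : 0 ≤ v) : -4 * v / (1 + v ^ 2) ^ 2 ≤ 0 :=
  div_nonpos_of_nonpos_of_nonneg (by linarith) (by positivity)

/-- The primitive used in the integration by parts:
`Ξ(v) = (i/(4k)) Y(v)^s (v⁻¹ - iv)`, with `Ξ · (E^k)' = E^k Y^s A`. [folklore] -/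
def slitXi (k : ℤ) (s : ℕ) (v : ℝ) : ℂ := I / (4 * k) * (((slitY v : ℝ) : ℂ) ^ s * ((v : ℂ)⁻¹ - I * v))

/-- `Ξ(v) · (E^k)'(v) = E^k Y^s A` for `v ≠ 0`, `k ≠ 0`. [folklore] -/
theorem slitXi_mul_deriv {k : ℤ} (hk : k ≠ 0) (s : ℕ) {v : ℝ} (hv : v ≠ 0) :
    slitXi k s v * (slitE v ^ k * (-4 * I * k * v / (1 + (v : ℂ) ^ 4))) = slitJFun k s v := by
  have hv0 : (v : ℂ) ≠ 0 := by exact_mod_cast hv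
  have hk0 : (k : ℂ) ≠ 0 := by exact_mod_cast hk
  have h1 := one_add_I_mul_sq_ne_zero v
  have h2 := one_sub_I_mul_sq_ne_zero v
  have h4 : ((1 : ℂ) + (v : ℂ) ^ 4) ≠ 0 := by rw [← one_sub_I_mul_sq_mul]; exact mul_ne_zero h2 h1
  rw [slitXi, slitJFun, slitA, ← one_sub_I_mul_sq_mul]
  field_simp
  ring_nf
  rw [Complex.I_sq]
  ring

/-- Derivative of `Ξ`. [folklore] -/
theorem hasDerivAt_slitXi (k : ℤ) (s : ℕ) {v : ℝ} (hv : v ≠ 0) :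
    HasDerivAt (slitXi k s) (I / (4 * k) * ((s * ((slitY v : ℝ) : ℂ) ^ (s - 1) * ((-4 * v / (1 + v ^ 2) ^ 2 : ℝ) : ℂ)) *
      ((v : ℂ)⁻¹ - I * v) + ((slitY v : ℝ) : ℂ) ^ s * (-((v : ℂ) ^ 2)⁻¹ - I))) v := by
  have hv0 : (v : ℂ) ≠ 0 := by exact_mod_cast hv
  have hY : HasDerivAt (fun x : ℝ => ((slitY x : ℝ) : ℂ) ^ s)
      (s * ((slitY v : ℝ) : ℂ) ^ (s - 1) * ((-4 * v / (1 + v ^ 2) ^ 2 : ℝ) : ℂ)) v :=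
    ((hasDerivAt_slitY v).ofReal_comp).pow s
  have hid : HasDerivAt (fun x : ℝ => (x : ℂ)) 1 v := (hasDerivAt_id v).ofReal_comp
  have hinv : HasDerivAt (fun x : ℝ => (x : ℂ)⁻¹) (-((v : ℂ) ^ 2)⁻¹) v := by
    have h := (hasDerivAt_inv hv0).comp v hid
    rw [mul_one] at h
    exact h
  have hlin : HasDerivAt (fun x : ℝ => (x : ℂ)⁻¹ - I * x) (-((v : ℂ) ^ 2)⁻¹ - I) v := by
    have h := hinv.sub (hid.const_mul I)
    rw [mul_one] at h
    exact h
  exact (hY.mul hlin).const_mul (I / (4 * k))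

/-! #### Bounds on `[ε, 1]` -/

/-- `|Y(v)| ≤ 1` for `v² ≤ 1`. [folklore] -/
theorem abs_slitY_le_one {v : ℝ} (hv : v ^ 2 ≤ 1) : |slitY v| ≤ 1 := by
  rw [abs_of_nonneg (slitY_nonneg hv)]; exact slitY_le_one v

/-- `‖v⁻¹ - iv‖ ≤ v⁻¹ + v` for `v > 0`. [folklore] -/
theorem norm_inv_sub_I_mul_le {v : ℝ} (hv : 0 < v) : ‖(v : ℂ)⁻¹ - I * v‖ ≤ v⁻¹ + v := by
  calc ‖(v : ℂ)⁻¹ - I * v‖ ≤ ‖(v : ℂ)⁻¹‖ + ‖I * (v : ℂ)‖ := norm_sub_le _ _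
    _ = v⁻¹ + v := by
        rw [norm_inv, Complex.norm_real, Real.norm_eq_abs, abs_of_pos hv, norm_mul, Complex.norm_I, one_mul,
          Complex.norm_real, Real.norm_eq_abs, abs_of_pos hv]

/-- `‖Ξ(v)‖ ≤ (v⁻¹ + v)/(4|k|)` on `(0, 1]`. [folklore] -/
theorem norm_slitXi_le {k : ℤ} (hk : k ≠ 0) (s : ℕ) {v : ℝ} (hv : 0 < v) (hv1 : v ≤ 1) :
    ‖slitXi k s v‖ ≤ (v⁻¹ + v) / (4 * |(k : ℝ)|) := by
  have hk0 : (0 : ℝ) < |(k : ℝ)| := abs_pos.2 (by exact_mod_cast hk)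
  have hv2 : v ^ 2 ≤ 1 := by nlinarith
  rw [slitXi, norm_mul, norm_mul, norm_div, Complex.norm_I, norm_mul, Complex.norm_ofNat, Complex.norm_intCast,
    norm_pow, Complex.norm_real, Real.norm_eq_abs]
  have h1 : |slitY v| ^ s ≤ 1 := pow_le_one₀ (abs_nonneg _) (abs_slitY_le_one hv2)
  have h2 := norm_inv_sub_I_mul_le hv
  calc 1 / (4 * |(k : ℝ)|) * (|slitY v| ^ s * ‖(v : ℂ)⁻¹ - I * v‖)
      ≤ 1 / (4 * |(k : ℝ)|) * (1 * (v⁻¹ + v)) := by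
        apply mul_le_mul_of_nonneg_left _ (by positivity)
        exact mul_le_mul h1 h2 (norm_nonneg _) zero_le_one
    _ = (v⁻¹ + v) / (4 * |(k : ℝ)|) := by ring

/-- The derivative bound: on `(0, 1]`,
`‖Ξ'(v)‖ ≤ (1/(4|k|)) [ (-(Y^s)')(v) (v⁻¹ + v) + (v⁻² + 1) ]`. [folklore] -/
theorem norm_deriv_slitXi_le {k : ℤ} (hk : k ≠ 0) (s : ℕ) {v : ℝ} (hv : 0 < v) (hv1 : v ≤ 1) :
    ‖I / (4 * k) * ((s * ((slitY v : ℝ) : ℂ) ^ (s - 1) * ((-4 * v / (1 + v ^ 2) ^ 2 : ℝ) : ℂ)) *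
      ((v : ℂ)⁻¹ - I * v) + ((slitY v : ℝ) : ℂ) ^ s * (-((v : ℂ) ^ 2)⁻¹ - I))‖ ≤
      1 / (4 * |(k : ℝ)|) * (-(s * slitY v ^ (s - 1) * (-4 * v / (1 + v ^ 2) ^ 2)) * (v⁻¹ + v) +
        ((v ^ 2)⁻¹ + 1)) := by
  have hk0 : (0 : ℝ) < |(k : ℝ)| := abs_pos.2 (by exact_mod_cast hk)
  have hv2 : v ^ 2 ≤ 1 := by nlinarith
  have hY0 : 0 ≤ slitY v := slitY_nonneg hv2
  have hD : -4 * v / (1 + v ^ 2) ^ 2 ≤ 0 := deriv_slitY_nonpos hv.le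
  rw [norm_mul, norm_div, Complex.norm_I, norm_mul, Complex.norm_ofNat, Complex.norm_intCast]
  refine mul_le_mul_of_nonneg_left ?_ (by positivity)
  refine (norm_add_le _ _).trans (add_le_add ?_ ?_)
  · rw [norm_mul, norm_mul, norm_mul, Complex.norm_natCast, norm_pow, Complex.norm_real, Complex.norm_real,
      Real.norm_eq_abs, Real.norm_eq_abs, abs_of_nonneg hY0, abs_of_nonpos hD]
    have : (s : ℝ) * slitY v ^ (s - 1) * -(-4 * v / (1 + v ^ 2) ^ 2) =
        -(s * slitY v ^ (s - 1) * (-4 * v / (1 + v ^ 2) ^ 2)) := by ring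
    rw [this]
    refine mul_le_mul_of_nonneg_left (norm_inv_sub_I_mul_le hv) ?_
    rw [← this]
    exact mul_nonneg (mul_nonneg (Nat.cast_nonneg s) (pow_nonneg hY0 _)) (by linarith)
  · rw [norm_mul, norm_pow, Complex.norm_real, Real.norm_eq_abs, abs_of_nonneg hY0]
    have h1 : slitY v ^ s ≤ 1 := pow_le_one₀ hY0 (slitY_le_one v)
    have h2 : ‖-((v : ℂ) ^ 2)⁻¹ - I‖ ≤ (v ^ 2)⁻¹ + 1 := by
      calc ‖-((v : ℂ) ^ 2)⁻¹ - I‖ ≤ ‖-((v : ℂ) ^ 2)⁻¹‖ + ‖I‖ := norm_sub_le _ _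
        _ = (v ^ 2)⁻¹ + 1 := by
            rw [norm_neg, norm_inv, norm_pow, Complex.norm_real, Real.norm_eq_abs, abs_of_pos hv, Complex.norm_I]
    calc slitY v ^ s * ‖-((v : ℂ) ^ 2)⁻¹ - I‖ ≤ 1 * ((v ^ 2)⁻¹ + 1) :=
          mul_le_mul h1 h2 (norm_nonneg _) zero_le_one
      _ = (v ^ 2)⁻¹ + 1 := one_mul _

/-- **The integration by parts**: for `k ≠ 0` and `0 < ε ≤ 1`,
`|J(k, s)| ≤ ε + 2/(|k| ε)`. [folklore] -/
theorem norm_slitJ_le_of_pos {k : ℤ} (hk : k ≠ 0) (s : ℕ) {ε : ℝ} (hε : 0 < ε) (hε1 : ε ≤ 1) :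
    ‖slitJ k s‖ ≤ ε + 2 / (|(k : ℝ)| * ε) := by
  have hk0 : (0 : ℝ) < |(k : ℝ)| := abs_pos.2 (by exact_mod_cast hk)
  have hI := intervalIntegrable_slitJFun k s
  -- split at `ε`
  have hsplit : slitJ k s = (∫ v in (0 : ℝ)..ε, slitJFun k s v) + ∫ v in ε..1, slitJFun k s v :=
    (intervalIntegral.integral_add_adjacent_intervals (hI 0 ε) (hI ε 1)).symm
  -- the short piece
  have hshort : ‖∫ v in (0 : ℝ)..ε, slitJFun k s v‖ ≤ ε := by
    have h := intervalIntegral.norm_integral_le_of_norm_le_const (a := 0) (b := ε) (C := 1)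
      (f := slitJFun k s) fun v hv => ?_
    · simpa [abs_of_pos hε] using h
    · rw [uIoc_of_le hε.le] at hv
      have hv2 : v ^ 2 ≤ 1 := by nlinarith [hv.1, hv.2]
      exact (norm_slitJFun_le hv2 k s).trans (pow_le_one₀ (slitY_nonneg hv2) (slitY_le_one v))
  -- integration by parts on `[ε, 1]`
  set Ξ' : ℝ → ℂ := fun v => I / (4 * k) * ((s * ((slitY v : ℝ) : ℂ) ^ (s - 1) *
    ((-4 * v / (1 + v ^ 2) ^ 2 : ℝ) : ℂ)) * ((v : ℂ)⁻¹ - I * v) + ((slitY v : ℝ) : ℂ) ^ s * (-((v : ℂ) ^ 2)⁻¹ - I))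
    with hΞ'
  set E' : ℝ → ℂ := fun v => slitE v ^ k * (-4 * I * k * v / (1 + (v : ℂ) ^ 4)) with hE'
  have hmem : ∀ v ∈ [[ε, (1 : ℝ)]], 0 < v ∧ v ≤ 1 := by
    intro v hv; rw [uIcc_of_le hε1] at hv; exact ⟨hε.trans_le hv.1, hv.2⟩
  have hcontΞ' : ContinuousOn Ξ' [[ε, 1]] := by
    have h4 : ∀ v ∈ [[ε, (1 : ℝ)]], (v : ℂ) ≠ 0 := fun v hv => by exact_mod_cast (hmem v hv).1.ne'
    refine ContinuousOn.mul continuousOn_const (ContinuousOn.add ?_ ?_)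
    · refine ContinuousOn.mul (Continuous.continuousOn ?_) ?_
      · refine Continuous.mul (Continuous.mul continuous_const ((continuous_ofReal.comp continuous_slitY).pow _)) ?_
        exact continuous_ofReal.comp continuous_derivY
      · exact ContinuousOn.sub (ContinuousOn.inv₀ (by fun_prop) h4) (Continuous.continuousOn (by fun_prop))
    · refine ContinuousOn.mul (Continuous.continuousOn ((continuous_ofReal.comp continuous_slitY).pow _)) ?_
      refine ContinuousOn.sub (ContinuousOn.neg (ContinuousOn.inv₀ (by fun_prop) fun v hv => ?_)) continuousOn_const
      exact pow_ne_zero 2 (h4 v hv)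
  have hcontE' : Continuous E' := by
    refine Continuous.mul (continuous_slitE.zpow₀ k fun v => Or.inl (slitE_ne_zero v)) ?_
    refine Continuous.div (by fun_prop) (by fun_prop) fun v => ?_
    rw [← one_sub_I_mul_sq_mul]; exact mul_ne_zero (one_sub_I_mul_sq_ne_zero v) (one_add_I_mul_sq_ne_zero v)
  have hparts := intervalIntegral.integral_mul_deriv_eq_deriv_mul (a := ε) (b := 1)
    (u := slitXi k s) (u' := Ξ') (v := fun x => slitE x ^ k) (v' := E')
    (fun v hv => hasDerivAt_slitXi k s (hmem v hv).1.ne') (fun v _ => hasDerivAt_slitE_zpow k v)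
    (hcontΞ'.intervalIntegrable) (hcontE'.intervalIntegrable _ _)
  have hlong_eq : ∫ v in ε..1, slitJFun k s v = ∫ v in ε..1, slitXi k s v * E' v := by
    refine intervalIntegral.integral_congr fun v hv => ?_
    exact (slitXi_mul_deriv hk s (hmem v hv).1.ne').symm
  -- bound the pieces
  have hb1 : ‖slitXi k s 1 * slitE 1 ^ k‖ ≤ 1 / (2 * |(k : ℝ)|) := by
    rw [norm_mul, norm_slitE_zpow, mul_one]
    refine (norm_slitXi_le hk s zero_lt_one le_rfl).trans ?_
    rw [inv_one, show ((1 : ℝ) + 1) / (4 * |(k : ℝ)|) = 1 / (2 * |(k : ℝ)|) by ring]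
  have hbε : ‖slitXi k s ε * slitE ε ^ k‖ ≤ 1 / (2 * |(k : ℝ)| * ε) := by
    rw [norm_mul, norm_slitE_zpow, mul_one]
    refine (norm_slitXi_le hk s hε hε1).trans ?_
    rw [div_le_div_iff₀ (by positivity) (by positivity)]
    have : ε ^ 2 ≤ 1 := by nlinarith
    field_simp
    nlinarith
  have hrest : ‖∫ v in ε..1, Ξ' v * slitE v ^ k‖ ≤ 1 / (4 * |(k : ℝ)|) * (2 / ε + ε⁻¹) := by
    have hbound : ∀ v ∈ Ioc ε 1, ‖Ξ' v * slitE v ^ k‖ ≤ 1 / (4 * |(k : ℝ)|) *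
        (-(s * slitY v ^ (s - 1) * (-4 * v / (1 + v ^ 2) ^ 2)) * (ε⁻¹ + 1) + ((v ^ 2)⁻¹ + 1)) := by
      intro v hv
      have hv0 : 0 < v := hε.trans hv.1
      rw [norm_mul, norm_slitE_zpow, mul_one]
      refine (norm_deriv_slitXi_le hk s hv0 hv.2).trans ?_
      have hD := deriv_slitY_nonpos hv0.le
      have hY0 : 0 ≤ slitY v := slitY_nonneg (by nlinarith [hv.1, hv.2])
      have hA : 0 ≤ -((s : ℝ) * slitY v ^ (s - 1) * (-4 * v / (1 + v ^ 2) ^ 2)) := by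
        have : 0 ≤ (s : ℝ) * slitY v ^ (s - 1) * -(-4 * v / (1 + v ^ 2) ^ 2) :=
          mul_nonneg (mul_nonneg (Nat.cast_nonneg s) (pow_nonneg hY0 _)) (by linarith)
        linarith
      refine mul_le_mul_of_nonneg_left (add_le_add (mul_le_mul_of_nonneg_left (add_le_add ?_ hv.2) hA) le_rfl)
        (by positivity)
      exact inv_anti₀ hε hv.1.le
    refine (intervalIntegral.norm_integral_le_of_norm_le hε1 (Eventually.of_forall fun v hv => hbound v hv) ?_).trans ?_
    · refine (ContinuousOn.intervalIntegrable ?_)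
      refine ContinuousOn.mul continuousOn_const (ContinuousOn.add (Continuous.continuousOn (by
        exact Continuous.mul (Continuous.neg (Continuous.mul (Continuous.mul continuous_const (continuous_slitY.pow _))
          continuous_derivY)) continuous_const)) ?_)
      refine ContinuousOn.add (ContinuousOn.inv₀ (by fun_prop) fun v hv => ?_) continuousOn_const
      exact pow_ne_zero 2 (hmem v hv).1.ne'
    -- evaluate the majorant: `∫_ε^1 -(Y^s)' (ε⁻¹+1) + (v⁻² + 1) = (ε⁻¹+1)(Y(ε)^s - Y(1)^s) + (ε⁻¹ - 1) + (1 - ε)`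
    have hFTC1 : ∫ v in ε..1, -((s : ℝ) * slitY v ^ (s - 1) * (-4 * v / (1 + v ^ 2) ^ 2)) * (ε⁻¹ + 1) =
        (slitY ε ^ s - slitY 1 ^ s) * (ε⁻¹ + 1) := by
      have hd : ∀ v ∈ [[ε, (1 : ℝ)]], HasDerivAt (fun x => slitY x ^ s) ((s : ℝ) * slitY v ^ (s - 1) *
          (-4 * v / (1 + v ^ 2) ^ 2)) v := fun v _ => (hasDerivAt_slitY v).pow s
      have h := intervalIntegral.integral_eq_sub_of_hasDerivAt hd ((Continuous.continuousOn (by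
        exact Continuous.mul (Continuous.mul continuous_const (continuous_slitY.pow _))
          continuous_derivY)).intervalIntegrable)
      rw [intervalIntegral.integral_mul_const, intervalIntegral.integral_neg, h]
      ring
    have hFTC2 : ∫ v in ε..1, ((v ^ 2)⁻¹ + 1) = (ε⁻¹ - 1) + (1 - ε) := by
      have hd : ∀ v ∈ [[ε, (1 : ℝ)]], HasDerivAt (fun x : ℝ => -x⁻¹ + x) ((v ^ 2)⁻¹ + 1) v := by
        intro v hv
        have hv0 : v ≠ 0 := (hmem v hv).1.ne'
        have h := (hasDerivAt_inv hv0).neg.add (hasDerivAt_id v)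
        rw [neg_neg] at h
        exact h
      have h := intervalIntegral.integral_eq_sub_of_hasDerivAt hd (ContinuousOn.intervalIntegrable (by
        refine ContinuousOn.add (ContinuousOn.inv₀ (by fun_prop) fun v hv => ?_) continuousOn_const
        exact pow_ne_zero 2 (hmem v hv).1.ne'))
      rw [h]; simp; ring
    rw [intervalIntegral.integral_const_mul, intervalIntegral.integral_add ?_ ?_, hFTC1, hFTC2]
    · have hYε : slitY ε ^ s ≤ 1 := pow_le_one₀ (slitY_nonneg (by nlinarith)) (slitY_le_one ε)
      have hY1 : 0 ≤ slitY 1 ^ s := pow_nonneg (slitY_nonneg (by norm_num)) s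
      refine mul_le_mul_of_nonneg_left ?_ (by positivity)
      have hε' : 1 ≤ ε⁻¹ := (one_le_inv₀ hε).2 hε1
      have h1 : (slitY ε ^ s - slitY 1 ^ s) * (ε⁻¹ + 1) ≤ 1 * (ε⁻¹ + 1) :=
        mul_le_mul_of_nonneg_right (by linarith) (by positivity)
      have h2 : 2 / ε = 2 * ε⁻¹ := div_eq_mul_inv _ _
      rw [h2]
      linarith
    · exact (Continuous.intervalIntegrable (by
        exact Continuous.mul (Continuous.neg (Continuous.mul (Continuous.mul continuous_const (continuous_slitY.pow _))
          continuous_derivY)) continuous_const) _ _)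
    · exact ContinuousOn.intervalIntegrable (by
        refine ContinuousOn.add (ContinuousOn.inv₀ (by fun_prop) fun v hv => ?_) continuousOn_const
        exact pow_ne_zero 2 (hmem v hv).1.ne')
  -- assemble
  have hlong : ‖∫ v in ε..1, slitJFun k s v‖ ≤ 1 / (2 * |(k : ℝ)|) + 1 / (2 * |(k : ℝ)| * ε) +
      1 / (4 * |(k : ℝ)|) * (2 / ε + ε⁻¹) := by
    rw [hlong_eq, hparts]
    refine (norm_sub_le _ _).trans (add_le_add ((norm_sub_le _ _).trans (add_le_add hb1 hbε)) hrest)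
  calc ‖slitJ k s‖ ≤ ‖∫ v in (0 : ℝ)..ε, slitJFun k s v‖ + ‖∫ v in ε..1, slitJFun k s v‖ := by
        rw [hsplit]; exact norm_add_le _ _
    _ ≤ ε + (1 / (2 * |(k : ℝ)|) + 1 / (2 * |(k : ℝ)| * ε) + 1 / (4 * |(k : ℝ)|) * (2 / ε + ε⁻¹)) :=
        add_le_add hshort hlong
    _ ≤ ε + 2 / (|(k : ℝ)| * ε) := by
        have e1 : 1 / (2 * |(k : ℝ)| * ε) = 1 / 2 * (1 / (|(k : ℝ)| * ε)) := by field_simp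
        have e2 : 1 / (4 * |(k : ℝ)|) * (2 / ε + ε⁻¹) = 3 / 4 * (1 / (|(k : ℝ)| * ε)) := by field_simp; ring
        have e3 : 1 / (2 * |(k : ℝ)|) ≤ 1 / 2 * (1 / (|(k : ℝ)| * ε)) := by
          rw [show 1 / 2 * (1 / (|(k : ℝ)| * ε)) = 1 / (2 * |(k : ℝ)| * ε) by field_simp]
          exact one_div_le_one_div_of_le (by positivity) (by nlinarith)
        have e4 : 2 / (|(k : ℝ)| * ε) = 2 * (1 / (|(k : ℝ)| * ε)) := by field_simp
        rw [e1, e2, e4]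
        have h2 : 0 ≤ 1 / (|(k : ℝ)| * ε) := by positivity
        linarith

/-- **Decay in `k`**: `|J(k, s)| ≤ 3/√|k|` for `k ≠ 0` (take `ε = |k|^{-1/2}`). [folklore] -/
theorem norm_slitJ_le_of_ne_zero {k : ℤ} (hk : k ≠ 0) (s : ℕ) : ‖slitJ k s‖ ≤ 3 / Real.sqrt |(k : ℝ)| := by
  have hk1 : (1 : ℝ) ≤ |(k : ℝ)| := by
    have : (1 : ℤ) ≤ |k| := Int.one_le_abs hk
    exact_mod_cast this
  have hk0 : (0 : ℝ) < |(k : ℝ)| := by linarith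
  set r := Real.sqrt |(k : ℝ)| with hr
  have hr0 : 0 < r := Real.sqrt_pos.2 hk0
  have hr1 : 1 ≤ r := by rw [hr]; exact Real.one_le_sqrt.2 hk1
  have hrsq : r ^ 2 = |(k : ℝ)| := Real.sq_sqrt hk0.le
  have h := norm_slitJ_le_of_pos hk s (inv_pos.2 hr0) (inv_le_one_of_one_le₀ hr1)
  rw [← hrsq] at h
  calc ‖slitJ k s‖ ≤ r⁻¹ + 2 / (r ^ 2 * r⁻¹) := h
    _ = 3 / r := by field_simp; ring


/-! ### Kesten's bound in all directions -/

/-- `|J(k, s)| ≤ 3/√M` with `M = max(1, |k|, s)`. [folklore] -/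
theorem norm_slitJ_le_max (k : ℤ) (s : ℕ) :
    ‖slitJ k s‖ ≤ 3 / Real.sqrt (max 1 (max |(k : ℝ)| s)) := by
  set M := max (1 : ℝ) (max |(k : ℝ)| s) with hM
  have hM1 : 1 ≤ M := le_max_left _ _
  have hM0 : 0 < M := by linarith
  rcases le_total (max |(k : ℝ)| (s : ℝ)) 1 with hle | hge
  · -- `M = 1`
    have : M = 1 := by rw [hM]; exact max_eq_left hle
    rw [this, Real.sqrt_one, div_one]
    linarith [norm_slitJ_le_one k s]
  · have hM' : M = max |(k : ℝ)| s := by rw [hM]; exact max_eq_right hge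
    rcases le_total (s : ℝ) |(k : ℝ)| with hsk | hks
    · -- `M = |k|`
      have hMk : M = |(k : ℝ)| := by rw [hM', max_eq_left hsk]
      have hk : k ≠ 0 := by
        intro h; rw [h] at hMk; simp at hMk; linarith
      rw [hMk]; exact norm_slitJ_le_of_ne_zero hk s
    · -- `M = s`
      have hMs : M = s := by rw [hM', max_eq_right hks]
      have hs1 : 1 ≤ s := by
        have : (1 : ℝ) ≤ s := by rw [← hMs]; exact hM1
        exact_mod_cast this
      rw [hMs]
      refine (norm_slitJ_le_sqrt k hs1).trans ?_
      have hs0 : (0 : ℝ) < s := by exact_mod_cast hs1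
      rw [Real.sqrt_div Real.pi_pos.le, div_div, div_le_div_iff₀ (by positivity) (by positivity)]
      have hπ : Real.sqrt π ≤ 2 := by
        rw [Real.sqrt_le_left (by norm_num)]; linarith [Real.pi_le_four]
      have := Real.sqrt_nonneg (s : ℝ)
      nlinarith

/-- `max(1, |k|, s) ≥ (1 + |k| + s)/3`. [folklore] -/
theorem max_ge_third (k : ℤ) (s : ℕ) : (1 + |(k : ℝ)| + s) / 3 ≤ max 1 (max |(k : ℝ)| s) := by
  have h1 : (1 : ℝ) ≤ max 1 (max |(k : ℝ)| s) := le_max_left _ _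
  have h2 : |(k : ℝ)| ≤ max 1 (max |(k : ℝ)| s) := (le_max_left _ _).trans (le_max_right _ _)
  have h3 : (s : ℝ) ≤ max 1 (max |(k : ℝ)| s) := (le_max_right _ _).trans (le_max_right _ _)
  linarith

/-- **`|J(k, s)| ≤ 6/√(1 + |k| + s)`.** [folklore] -/
theorem norm_slitJ_le (k : ℤ) (s : ℕ) : ‖slitJ k s‖ ≤ 6 / Real.sqrt (1 + |(k : ℝ)| + s) := by
  refine (norm_slitJ_le_max k s).trans ?_
  have hpos : (0 : ℝ) < 1 + |(k : ℝ)| + s := by positivity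
  have hM : (0 : ℝ) < max 1 (max |(k : ℝ)| s) := by positivity
  rw [div_le_div_iff₀ (Real.sqrt_pos.2 hM) (Real.sqrt_pos.2 hpos)]
  have h := max_ge_third k s
  have h1 : Real.sqrt (1 + |(k : ℝ)| + s) ≤ Real.sqrt 3 * Real.sqrt (max 1 (max |(k : ℝ)| s)) := by
    rw [← Real.sqrt_mul (by norm_num)]
    exact Real.sqrt_le_sqrt (by linarith)
  have h3 : Real.sqrt 3 ≤ 2 := by
    rw [Real.sqrt_le_left (by norm_num)]; norm_num
  have := Real.sqrt_nonneg (max 1 (max |(k : ℝ)| (s : ℝ)))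
  nlinarith

/-- **Kesten's estimate in all directions** (CHI Lemma 3.3, (3.3): `hm ≤ C δ^{1/2}|z - a|^{-1/2}`):
`|K(k, s)| ≤ 8/√(1 + |k| + s)`. [cite: ChelkakHonglerIzyurovAnnals2015, Lemma 3.3 (3.3)] -/
theorem abs_slitKernel_le (k : ℤ) (s : ℕ) : |slitKernel k s| ≤ 8 / Real.sqrt (1 + |(k : ℝ)| + s) := by
  rw [slitKernel_eq_re_slitJ, abs_mul, abs_of_pos (by positivity : (0 : ℝ) < 4 / π)]
  have h1 : |(cexp (π / 4 * I) * slitJ k s).re| ≤ ‖slitJ k s‖ := by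
    refine (abs_re_le_norm _).trans ?_
    rw [norm_mul, show (π / 4 * I : ℂ) = ((π / 4 : ℝ) : ℂ) * I by push_cast; ring, Complex.norm_exp_ofReal_mul_I,
      one_mul]
  have h2 := norm_slitJ_le k s
  have hπ : 4 / π ≤ 4 / 3 := div_le_div_of_nonneg_left (by norm_num) (by norm_num) Real.pi_gt_three.le
  have hpos : 0 < Real.sqrt (1 + |(k : ℝ)| + s) := Real.sqrt_pos.2 (by positivity)
  calc 4 / π * |(cexp (π / 4 * I) * slitJ k s).re| ≤ 4 / 3 * (6 / Real.sqrt (1 + |(k : ℝ)| + s)) :=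
        mul_le_mul hπ (h1.trans h2) (abs_nonneg _) (by positivity)
    _ = 8 / Real.sqrt (1 + |(k : ℝ)| + s) := by ring

/-- `|a + b| + |a - b| ≥ |a| + |b|`… in fact `= 2 max(|a|, |b|) ≥ |a| + |b|`. [folklore] -/
theorem abs_add_abs_sub_ge (a b : ℝ) : |a| + |b| ≤ |a + b| + |a - b| := by
  rcases le_total 0 (a + b) with h1 | h1 <;> rcases le_total 0 (a - b) with h2 | h2 <;>
    rcases le_total 0 a with h3 | h3 <;> rcases le_total 0 b with h4 | h4 <;>
    simp only [abs_of_nonneg, abs_of_nonpos, *] <;> linarith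

/-- **Decay of `slitHM` at infinity**: `|slitHM (a, b)| ≤ 8/√(1 + |a| + |b|)`.
[cite: ChelkakHonglerIzyurovAnnals2015, Lemma 3.3 (3.3)] -/
theorem abs_slitHM_le (v : Site 2) : |slitHM v| ≤ 8 / Real.sqrt (1 + |(v 0 : ℝ)| + |(v 1 : ℝ)|) := by
  rw [slitHM_apply]
  refine (abs_slitKernel_le _ _).trans ?_
  have hpos : (0 : ℝ) < 1 + |(v 0 : ℝ)| + |(v 1 : ℝ)| := by positivity
  apply div_le_div_of_nonneg_left (by norm_num) (Real.sqrt_pos.2 hpos)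
  apply Real.sqrt_le_sqrt
  have h := abs_add_abs_sub_ge (v 0 : ℝ) (v 1 : ℝ)
  have hc : (((v 0 - v 1).natAbs : ℕ) : ℝ) = |(v 0 : ℝ) - (v 1 : ℝ)| := by
    rw [Nat.cast_natAbs, Int.cast_abs, Int.cast_sub]
  push_cast
  rw [hc]
  linarith

/-! ### Positivity and boundedness by the maximum principle -/

/-- The slit: the diagonal ray `{(j, j) : j ≤ -1}`. [folklore] -/
def slitSet : Set (Site 2) := {w | w 0 = w 1 ∧ w 0 ≤ -1}

/-- A site with equal coordinates is a diagonal site `(j, j)`. [folklore] -/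
theorem eq_diag_of_apply_eq {w : Site 2} (h : w 0 = w 1) : w = ![w 0, w 0] := by
  ext i; fin_cases i
  · rfl
  · simp [h]

/-- **`slitHM` is lattice-harmonic off the tip and the slit.** [folklore] -/
theorem isLatticeHarmonicOn_slitHM : IsLatticeHarmonicOn slitHM ({0} ∪ slitSet)ᶜ := by
  intro w hw
  simp only [mem_compl_iff, mem_union, mem_singleton_iff, slitSet, mem_setOf_eq, not_or, not_and, not_le] at hw
  by_cases h : w 0 = w 1
  · have hj : 1 ≤ w 0 := by
      have h1 := hw.2 h
      rcases lt_trichotomy (w 0) 0 with hlt | heq | hgt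
      · omega
      · exfalso; apply hw.1; ext i; fin_cases i
        · exact heq
        · show w 1 = 0; rw [← h, heq]
      · omega
    rw [eq_diag_of_apply_eq h]
    exact latticeLaplacian_slitHM_diag_of_pos hj
  · exact latticeLaplacian_slitHM_of_ne h

/-- The box `{|a| + |b| < N}` is finite. [folklore] -/
theorem finite_absBox (N : ℕ) : {w : Site 2 | |w 0| + |w 1| < N}.Finite := by
  have h : {w : Site 2 | |w 0| + |w 1| < N} ⊆
      (fun p : ℤ × ℤ => (![p.1, p.2] : Site 2)) '' (Icc (-(N : ℤ)) N ×ˢ Icc (-(N : ℤ)) N) := by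
    intro w hw
    simp only [mem_setOf_eq] at hw
    refine ⟨(w 0, w 1), ⟨⟨?_, ?_⟩, ⟨?_, ?_⟩⟩, ?_⟩
    · have := abs_nonneg (w 1); have := neg_abs_le (w 0); omega
    · have := abs_nonneg (w 1); have := le_abs_self (w 0); omega
    · have := abs_nonneg (w 0); have := neg_abs_le (w 1); omega
    · have := abs_nonneg (w 0); have := le_abs_self (w 1); omega
    · ext i; fin_cases i <;> rfl
  exact ((finite_Icc _ _).prod (finite_Icc _ _)).image _ |>.subset h

/-- The punctured box `U_N = {|a| + |b| < N} ∖ ({0} ∪ slit)`. [folklore] -/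
def slitBox (N : ℕ) : Set (Site 2) := {w : Site 2 | |w 0| + |w 1| < N} ∩ ({0} ∪ slitSet)ᶜ

/-- `U_N` is finite. [folklore] -/
theorem finite_slitBox (N : ℕ) : (slitBox N).Finite := (finite_absBox N).subset inter_subset_left

/-- Values of `slitHM` off `U_N`: `1` at the tip, `0` on the slit, small outside the box. [folklore] -/
theorem slitHM_of_not_mem_slitBox {N : ℕ} {w : Site 2} (hw : w ∉ slitBox N) :
    (w = 0 ∧ slitHM w = 1) ∨ (w ∈ slitSet ∧ slitHM w = 0) ∨ |slitHM w| ≤ 8 / Real.sqrt (1 + N) := by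
  simp only [slitBox, mem_inter_iff, mem_setOf_eq, mem_compl_iff, mem_union, mem_singleton_iff, not_and, not_not] at hw
  by_cases hbox : |w 0| + |w 1| < N
  · rcases hw hbox with h | h
    · left; exact ⟨h, by rw [h]; exact slitHM_zero⟩
    · right; left
      refine ⟨h, ?_⟩
      rw [eq_diag_of_apply_eq h.1]
      exact slitHM_diag_of_neg h.2
  · right; right
    refine (abs_slitHM_le w).trans ?_
    apply div_le_div_of_nonneg_left (by norm_num) (Real.sqrt_pos.2 (by positivity))
    apply Real.sqrt_le_sqrt
    have : (N : ℤ) ≤ |w 0| + |w 1| := not_lt.1 hbox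
    have : (N : ℝ) ≤ |(w 0 : ℝ)| + |(w 1 : ℝ)| := by exact_mod_cast this
    linarith

/-- **Positivity**: `0 ≤ slitHM` (minimum principle on `U_N`, `N → ∞`). [folklore] -/
theorem slitHM_nonneg (v : Site 2) : 0 ≤ slitHM v := by
  by_contra hneg
  have hneg : slitHM v < 0 := lt_of_not_ge hneg
  -- choose `N` with `8/√(1+N) < -slitHM v` and `v` inside the box
  obtain ⟨N, hN⟩ : ∃ N : ℕ, |v 0| + |v 1| < N ∧ 8 / Real.sqrt (1 + N) < -slitHM v := by
    have hε : 0 < -slitHM v := by linarith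
    obtain ⟨N₁, hN₁⟩ := exists_nat_gt ((8 / -slitHM v) ^ 2 + (|(v 0 : ℝ)| + |(v 1 : ℝ)|))
    refine ⟨N₁, ?_, ?_⟩
    · have h0 : 0 ≤ (8 / -slitHM v) ^ 2 := sq_nonneg _
      have : |(v 0 : ℝ)| + |(v 1 : ℝ)| < N₁ := by linarith
      exact_mod_cast this
    · have h1 : (8 / -slitHM v) ^ 2 < 1 + N₁ := by
        have := abs_nonneg (v 0 : ℝ); have := abs_nonneg (v 1 : ℝ); linarith
      have h2 : 8 / -slitHM v < Real.sqrt (1 + N₁) := by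
        rw [← Real.sqrt_sq (by positivity : (0 : ℝ) ≤ 8 / -slitHM v)]
        exact Real.sqrt_lt_sqrt (sq_nonneg _) h1
      rw [div_lt_iff₀ (Real.sqrt_pos.2 (by positivity))]
      rw [div_lt_iff₀ hε] at h2
      linarith
  have hpos : 0 ≤ 8 / Real.sqrt (1 + N) := by positivity
  by_cases hv : v ∈ slitBox N
  · have hharm : IsLatticeHarmonicOn slitHM (slitBox N) := fun w hw => isLatticeHarmonicOn_slitHM w hw.2
    have hmin := hharm.superharmonicOn.ge_of_forall_boundary_ge (finite_slitBox N)
      (M := -(8 / Real.sqrt (1 + N))) ?_ v hv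
    · linarith [hN.2]
    · intro w hw
      rcases slitHM_of_not_mem_slitBox hw.1 with ⟨-, h⟩ | ⟨-, h⟩ | h
      · rw [h]; linarith
      · rw [h]; linarith
      · linarith [neg_abs_le (slitHM w)]
  · rcases slitHM_of_not_mem_slitBox hv with ⟨-, h⟩ | ⟨-, h⟩ | h
    · linarith
    · linarith
    · linarith [neg_abs_le (slitHM v), hN.2]


/-- **Boundedness**: `slitHM ≤ 1` (maximum principle on `U_N`, `N → ∞`). [folklore] -/
theorem slitHM_le_one (v : Site 2) : slitHM v ≤ 1 := by
  by_contra hgt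
  have hgt : 1 < slitHM v := lt_of_not_ge hgt
  obtain ⟨N, hN⟩ : ∃ N : ℕ, |v 0| + |v 1| < N ∧ 8 / Real.sqrt (1 + N) < slitHM v - 1 := by
    have hε : 0 < slitHM v - 1 := by linarith
    obtain ⟨N₁, hN₁⟩ := exists_nat_gt ((8 / (slitHM v - 1)) ^ 2 + (|(v 0 : ℝ)| + |(v 1 : ℝ)|))
    refine ⟨N₁, ?_, ?_⟩
    · have h0 : 0 ≤ (8 / (slitHM v - 1)) ^ 2 := sq_nonneg _
      have : |(v 0 : ℝ)| + |(v 1 : ℝ)| < N₁ := by linarith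
      exact_mod_cast this
    · have h1 : (8 / (slitHM v - 1)) ^ 2 < 1 + N₁ := by
        have := abs_nonneg (v 0 : ℝ); have := abs_nonneg (v 1 : ℝ); linarith
      have h2 : 8 / (slitHM v - 1) < Real.sqrt (1 + N₁) := by
        rw [← Real.sqrt_sq (by positivity : (0 : ℝ) ≤ 8 / (slitHM v - 1))]
        exact Real.sqrt_lt_sqrt (sq_nonneg _) h1
      rw [div_lt_iff₀ (Real.sqrt_pos.2 (by positivity))]
      rw [div_lt_iff₀ hε] at h2
      linarith
  have hpos : 0 ≤ 8 / Real.sqrt (1 + N) := by positivity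
  by_cases hv : v ∈ slitBox N
  · have hharm : IsLatticeHarmonicOn slitHM (slitBox N) := fun w hw => isLatticeHarmonicOn_slitHM w hw.2
    have hmax := hharm.subharmonicOn.le_of_forall_boundary_le (finite_slitBox N)
      (M := 1 + 8 / Real.sqrt (1 + N)) ?_ v hv
    · linarith [hN.2]
    · intro w hw
      rcases slitHM_of_not_mem_slitBox hw.1 with ⟨-, h⟩ | ⟨-, h⟩ | h
      · rw [h]; linarith
      · rw [h]; linarith
      · linarith [le_abs_self (slitHM w)]
  · rcases slitHM_of_not_mem_slitBox hv with ⟨-, h⟩ | ⟨-, h⟩ | h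
    · linarith
    · linarith
    · linarith [le_abs_self (slitHM v), hN.2]

/-! ### Identification: the tip harmonic measures of the boxes converge to `slitHM` -/

/-- The Dirichlet data of the tip harmonic measure: `1` at the tip, `0` elsewhere. [folklore] -/
def tipData (w : Site 2) : ℝ := if w = 0 then 1 else 0

/-- **The tip harmonic measure of the punctured box `U_N`**: the lattice-harmonic function on
`U_N = {|a| + |b| < N} ∖ ({0} ∪ slit)` with value `1` at the tip and `0` on the slit and outside
the box — in random-walk terms the probability of hitting the tip before the slit and before
leaving the box (CHI's `hm^{Ξ_δ}_{a+3δ/2}` in finite volume). [folklore] -/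
def slitHMBox (N : ℕ) : Site 2 → ℝ := harmExt (slitBox N) tipData

/-- `slitHMBox N` is harmonic on `U_N`. [folklore] -/
theorem slitHMBox_harmonicOn (N : ℕ) : IsLatticeHarmonicOn (slitHMBox N) (slitBox N) :=
  harmExt_harmonicOn (finite_slitBox N) _

/-- Off `U_N`, `slitHMBox N` is the data. [folklore] -/
theorem slitHMBox_of_not_mem {N : ℕ} {w : Site 2} (hw : w ∉ slitBox N) : slitHMBox N w = tipData w :=
  harmExt_of_not_mem (finite_slitBox N) _ hw

/-- `0 ≤ slitHMBox N ≤ 1`. [folklore] -/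
theorem slitHMBox_mem_Icc (N : ℕ) (w : Site 2) : slitHMBox N w ∈ Icc (0 : ℝ) 1 := by
  have h0 : ∀ w, (0 : ℝ) ≤ tipData w := fun w => by unfold tipData; split_ifs <;> norm_num
  have h1 : ∀ w, tipData w ≤ (1 : ℝ) := fun w => by unfold tipData; split_ifs <;> norm_num
  exact ⟨le_harmExt' (finite_slitBox N) h0 w, harmExt_le' (finite_slitBox N) h1 w⟩

/-- A slit site is not the tip. [folklore] -/
theorem ne_zero_of_mem_slitSet {w : Site 2} (hw : w ∈ slitSet) : w ≠ 0 := by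
  rintro rfl
  simp [slitSet] at hw

/-- Off `U_N`, `slitHM` and the data differ by at most `8/√(1+N)`. [folklore] -/
theorem abs_slitHM_sub_tipData_le {N : ℕ} {w : Site 2} (hw : w ∉ slitBox N) :
    |slitHM w - tipData w| ≤ 8 / Real.sqrt (1 + N) := by
  have hpos : 0 ≤ 8 / Real.sqrt (1 + N) := by positivity
  rcases slitHM_of_not_mem_slitBox hw with ⟨h0, h⟩ | ⟨hs, h⟩ | h
  · rw [h, h0, tipData, if_pos rfl, sub_self, abs_zero]; exact hpos
  · rw [h, tipData, if_neg (ne_zero_of_mem_slitSet hs), sub_zero, abs_zero]; exact hpos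
  · by_cases h0 : w = 0
    · rw [h0, slitHM_zero, tipData, if_pos rfl, sub_self, abs_zero]; exact hpos
    · rw [tipData, if_neg h0, sub_zero]; exact h

/-- **`slitHM` is the infinite-volume tip harmonic measure**: the tip harmonic measures of the
punctured boxes `U_N` converge to it uniformly, `|slitHM - slitHMBox N| ≤ 8/√(1+N)` everywhere
(comparison principle on `U_N` with the decay `abs_slitHM_le` on the outer boundary). This is the
identification of the closed form with CHI's `F¹_{[ℂ_δ,a]} = hm^{Ξ_δ}_{a+3δ/2}` (proof of Lemma 2.14).
[cite: ChelkakHonglerIzyurovAnnals2015, §3.2.2, proof of Lemma 2.14 (F-1-as-hm)] -/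
theorem abs_slitHM_sub_slitHMBox_le (N : ℕ) (w : Site 2) : |slitHM w - slitHMBox N w| ≤ 8 / Real.sqrt (1 + N) := by
  by_cases hw : w ∈ slitBox N
  · have hfin := finite_slitBox N
    have hharm : IsLatticeHarmonicOn slitHM (slitBox N) := fun w hw => isLatticeHarmonicOn_slitHM w hw.2
    have hb : ∀ w' ∈ latticeOuterBoundary (slitBox N), |slitHM w' - slitHMBox N w'| ≤ 8 / Real.sqrt (1 + N) := by
      intro w' hw'
      rw [slitHMBox_of_not_mem hw'.1]
      exact abs_slitHM_sub_tipData_le hw'.1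
    rw [abs_le]
    constructor
    · have := le_of_sub_super_of_boundary hfin (slitHMBox_harmonicOn N).subharmonicOn hharm.superharmonicOn
        (c := 8 / Real.sqrt (1 + N)) (fun w' hw' => by linarith [(abs_le.1 (hb w' hw')).1]) w hw
      linarith
    · have := le_of_sub_super_of_boundary hfin hharm.subharmonicOn (slitHMBox_harmonicOn N).superharmonicOn
        (c := 8 / Real.sqrt (1 + N)) (fun w' hw' => by linarith [(abs_le.1 (hb w' hw')).2]) w hw
      linarith
  · rw [slitHMBox_of_not_mem hw]
    exact abs_slitHM_sub_tipData_le hw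

/-- **Convergence**: `slitHMBox N w → slitHM w` as `N → ∞`, for every site `w`. [folklore] -/
theorem tendsto_slitHMBox (w : Site 2) : Tendsto (fun N : ℕ => slitHMBox N w) atTop (𝓝 (slitHM w)) := by
  have h : Tendsto (fun N : ℕ => 8 / Real.sqrt (1 + (N : ℝ))) atTop (𝓝 0) := by
    have h1 : Tendsto (fun N : ℕ => Real.sqrt (1 + (N : ℝ))) atTop atTop := by
      refine Real.tendsto_sqrt_atTop.comp ?_
      exact tendsto_atTop_add_const_left _ _ tendsto_natCast_atTop_atTop
    simpa using h1.const_div_atTop 8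
  rw [Metric.tendsto_atTop]
  intro ε hε
  rw [Metric.tendsto_atTop] at h
  obtain ⟨N₀, hN₀⟩ := h ε hε
  refine ⟨N₀, fun N hN => ?_⟩
  have h1 := hN₀ N hN
  rw [Real.dist_eq, sub_zero, abs_of_nonneg (by positivity)] at h1
  rw [Real.dist_eq, abs_sub_comm]
  exact (abs_slitHM_sub_slitHMBox_le N w).trans_lt h1

end Literature.Probability.LatticeModels
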